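import Summits.BirchSwinnertonDyer.BirchSwinnertonDyer.Theorems.SignedBaseChangeAnticyclotomicEisensteinDivisibilitySpecializationCyclic
import Literature.NumberTheory.EllipticCurves.IwasawaAlgebraSpecialization
import HarnessLib

/-!
# The named fact `IwasawaAlgebra.Delbourgo2008_lemma_10_5_specialization` is false AS TYPED
# (instance trap: `T ↦ T₁` instead of the constants) — a counterexample

Helper file (--supports stmt-BirchSwinnertonDyer-20727; evidence for the planner/typer); companion of `IwasawaAlgebraSpecialization.lean` (named facts,
p558003) and of the proof files the three `…Specialization{Length,Cyclic,Herbrand}.lean` files (which PROVE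
the intended statement as `TwoVar.map_constantCoeff_charIdeal_eq`).

The named fact quantifies over `[Module (IwasawaAlgebra p) M] [IsScalarTower (IwasawaAlgebra p)
(PowerSeries (IwasawaAlgebra p)) M]`; the `SMul Λ₁ Λ₂` inside `IsScalarTower` is found by instance
resolution, and Mathlib's highest-priority match is `PowerSeries.algebraPowerSeries : Algebra R⟦X⟧ A⟦X⟧`
(for `Algebra R A`; here `R = ℤ_p`, `A = Λ₁`), whose `algebraMap = PowerSeries.map (algebraMap ℤ_p Λ₁)`
sends the variable `T` of `Λ₁ = ℤ_p⟦T⟧` to the OUTER variable `T₁` of `Λ₂ = Λ₁⟦T₁⟧` — not to the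
constant `T₂ = C T` that the docstring ("the `Λ₁`-structure … is the restriction along the constants
`Λ₁ → Λ₂`") intends. Consequently `T` acts on `M/T₁M` as `T₁ = 0`, `ch_{Λ₁}(M/T₁M)` can only involve
the prime `(T)`, and the typed equality `π(ch_{Λ₂} M) = ch_{Λ₁}(M ⧸ T₁M)` FAILS for `M = Λ₂/(p)`:
all three hypotheses hold (`M` f.g. torsion; `T₁` injective on `Λ₂/(p)` as `p ∤ T₁`; `M/T₁M` killed by
`T`), `π(ch_{Λ₂} M) = π((p)) = (p) ≠ Λ₁`, while `M/T₁M = Λ₂/(p, T₁)` is killed by `T` and by `p`, so all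
its local lengths at height-one primes of `Λ₁` vanish and `ch_{Λ₁}(M/T₁M) = 1`.

* `TwoVar.not_Delbourgo2008_lemma_10_5_specialization_quotient_p` :
  `¬ Literature.NumberTheory.EllipticCurves.IwasawaAlgebra.Delbourgo2008_lemma_10_5_specialization p (Λ₂ ⧸ (p))`.

So no `_holds` discharge of the fact as typed exists; the REPAIR is to pin the constants structure
(e.g. `letI := Module.compHom _ PowerSeries.C`, as in `map_constantCoeff_charIdeal_eq`, or a hypothesis
`∀ a m, a • m = PowerSeries.C a • m`). Nothing about elliptic curves is asserted.

## References

* D. Delbourgo, *Elliptic Curves and Big Galois Representations*, LMS LNS 356, CUP 2008, Ch. X,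
  Lemma 10.5. [Delbourgo2008]
-/

noncomputable section

open Function
open scoped Pointwise

-- D-0017: single-problem summit, the namespace repeats the problem name by design.
set_option linter.dupNamespace false
set_option autoImplicit false

namespace Summit.BirchSwinnertonDyer.BirchSwinnertonDyer.Theorems.SignedBaseChangeAcDivSpecialization

open Literature.NumberTheory.EllipticCurves Literature.NumberTheory.EllipticCurves.Module

namespace TwoVar

open LocalLength PowerSeriesSpecialization

/-! ### The named fact `Delbourgo2008_lemma_10_5_specialization` AS TYPED is refutable

The binder `[IsScalarTower (IwasawaAlgebra p) (PowerSeries (IwasawaAlgebra p)) M]` of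
`IwasawaAlgebraSpecialization.lean` elaborates (Mathlib instance priority) to the scalar tower for
`PowerSeries.algebraPowerSeries : Algebra Λ₁ Λ₂`, i.e. `algebraMap = PowerSeries.map (algebraMap ℤ_p Λ₁)`,
which sends the variable `T` of `Λ₁` to the OUTER variable `T₁` of `Λ₂` — not to `T₂` as the docstring
intends. Under that structure `T` acts on `M/T₁M` as `T₁`, i.e. as `0`, so `ch_{Λ₁}(M/T₁M)` only sees
the prime `(T)`, and the typed equality fails already for `M = Λ₂/(p)`:
`π(ch_{Λ₂} M) = (p) ≠ 1 = ch_{Λ₁}(Λ₂/(p, T₁))`. The intended statement is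
`map_constantCoeff_charIdeal_eq` above. -/

/-- **Counterexample to the typed named fact.** For `M = Λ₂/(p)` (with the instance-resolved
`Λ₁`-structure, `T ↦ T₁`): `M` is finitely generated torsion, `T₁` is injective on `M`, `M/T₁M` is
`Λ₁`-torsion (killed by `T`), but `π(ch_{Λ₂} M) = (p)` while `ch_{Λ₁}(M/T₁M) = 1`. Hence
`Delbourgo2008_lemma_10_5_specialization p (Λ₂/(p))` is FALSE; the fact must be restated with the
constants structure (`map_constantCoeff_charIdeal_eq`). [cite: Delbourgo2008, Ch. X Lemma 10.5] -/
theorem not_Delbourgo2008_lemma_10_5_specialization_quotient_p (p : ℕ) [Fact p.Prime] :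
    ¬ Literature.NumberTheory.EllipticCurves.IwasawaAlgebra.Delbourgo2008_lemma_10_5_specialization p
      (PowerSeries (IwasawaAlgebra p) ⧸ Ideal.span {(PowerSeries.C (PowerSeries.C (p : ℤ_[p])) :
        PowerSeries (IwasawaAlgebra p))}) := by
  intro h
  have hprime : Prime (PowerSeries.C (PowerSeries.C (p : ℤ_[p])) : PowerSeries (IwasawaAlgebra p)) :=
    prime_C_of_prime (IwasawaAlgebra.prime_C p)
  set π : PowerSeries (IwasawaAlgebra p) := PowerSeries.C (PowerSeries.C (p : ℤ_[p])) with hπ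
  set I : Ideal (PowerSeries (IwasawaAlgebra p)) := Ideal.span {π} with hI
  haveI hIp : I.IsPrime := (Ideal.span_singleton_prime hprime.ne_zero).mpr hprime
  have hπI : ∀ a : PowerSeries (IwasawaAlgebra p), Ideal.Quotient.mk I (π * a) = 0 := fun a =>
    Ideal.Quotient.eq_zero_iff_mem.mpr (Ideal.mul_mem_right _ _ (Ideal.mem_span_singleton_self π))
  -- the three hypotheses of the fact
  have hM : Module.IsTorsion (PowerSeries (IwasawaAlgebra p)) (PowerSeries (IwasawaAlgebra p) ⧸ I) := by
    intro x
    obtain ⟨a, rfl⟩ := Ideal.Quotient.mk_surjective x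
    exact ⟨⟨π, mem_nonZeroDivisors_of_ne_zero hprime.ne_zero⟩, hπI a⟩
  have hXπ : ¬ π ∣ (PowerSeries.X : PowerSeries (IwasawaAlgebra p)) := by
    rintro ⟨c, hc⟩
    have h1 := congrArg (PowerSeries.coeff 1) hc
    rw [PowerSeries.coeff_one_X, hπ, PowerSeries.coeff_C_mul] at h1
    exact (IwasawaAlgebra.prime_C p).not_unit (IsUnit.of_mul_eq_one _ h1.symm)
  have hT₁ : ∀ m : PowerSeries (IwasawaAlgebra p) ⧸ I,
      (PowerSeries.X : PowerSeries (IwasawaAlgebra p)) • m = 0 → m = 0 := by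
    intro m hm
    obtain ⟨a, rfl⟩ := Ideal.Quotient.mk_surjective m
    change Ideal.Quotient.mk I (PowerSeries.X * a) = 0 at hm
    rw [Ideal.Quotient.eq_zero_iff_mem, hI, Ideal.mem_span_singleton] at hm
    rw [Ideal.Quotient.eq_zero_iff_mem, hI, Ideal.mem_span_singleton]
    exact (hprime.dvd_or_dvd hm).resolve_left hXπ
  -- under the instance-resolved structure, `T ∈ Λ₁` acts on `Λ₂/I` as `T₁ = X`, and `p` as `π`
  have hTact : ∀ x : PowerSeries (IwasawaAlgebra p) ⧸ I,
      (PowerSeries.X : IwasawaAlgebra p) • x = (PowerSeries.X : PowerSeries (IwasawaAlgebra p)) • x := by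
    intro x
    rw [← IsScalarTower.algebraMap_smul (PowerSeries (IwasawaAlgebra p))
      (PowerSeries.X : IwasawaAlgebra p) x, PowerSeries.algebraMap_apply'', PowerSeries.map_X]
  have hpact : ∀ x : PowerSeries (IwasawaAlgebra p) ⧸ I,
      (PowerSeries.C (p : ℤ_[p]) : IwasawaAlgebra p) • x = 0 := by
    intro x
    obtain ⟨a, rfl⟩ := Ideal.Quotient.mk_surjective x
    rw [← IsScalarTower.algebraMap_smul (PowerSeries (IwasawaAlgebra p))
      (PowerSeries.C (p : ℤ_[p]) : IwasawaAlgebra p), PowerSeries.algebraMap_apply'',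
      PowerSeries.map_C, ← PowerSeries.C_eq_algebraMap]
    exact hπI a
  have hq : Module.IsTorsion (IwasawaAlgebra p) ((PowerSeries (IwasawaAlgebra p) ⧸ I) ⧸
      (Ideal.span {(PowerSeries.X : PowerSeries (IwasawaAlgebra p))} •
        (⊤ : Submodule (PowerSeries (IwasawaAlgebra p)) (PowerSeries (IwasawaAlgebra p) ⧸ I)))) := by
    intro y
    obtain ⟨x, rfl⟩ := Submodule.Quotient.mk_surjective _ y
    refine ⟨⟨PowerSeries.X, mem_nonZeroDivisors_of_ne_zero PowerSeries.X_ne_zero⟩, ?_⟩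
    rw [Submonoid.smul_def, ← Submodule.Quotient.mk_smul, Submodule.Quotient.mk_eq_zero]
    change (PowerSeries.X : IwasawaAlgebra p) • x ∈ _
    rw [hTact, Submodule.ideal_span_singleton_smul]
    exact Submodule.smul_mem_pointwise_smul _ _ _ Submodule.mem_top
  have heq := h hM hT₁ hq
  -- LHS = (p) ⊂ Λ₁
  let 𝔭 : PrimeSpectrum (PowerSeries (IwasawaAlgebra p)) := ⟨I, hIp⟩
  have hch : charIdeal (PowerSeries (IwasawaAlgebra p)) (PowerSeries (IwasawaAlgebra p) ⧸ I) = I :=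
    charIdeal_quotient_prime_of_height_eq_one 𝔭 (height_span_singleton_eq_one_of_prime hprime)
  have hL : (charIdeal (PowerSeries (IwasawaAlgebra p)) (PowerSeries (IwasawaAlgebra p) ⧸ I)).map
      (PowerSeries.constantCoeff (R := IwasawaAlgebra p)) =
        Ideal.span {(PowerSeries.C (p : ℤ_[p]) : IwasawaAlgebra p)} := by
    rw [hch, hI, Ideal.map_span, Set.image_singleton, hπ, PowerSeries.constantCoeff_C]
  -- RHS = 1: the quotient is killed by `T` (acting as `T₁`) and by `p`
  have hR : charIdeal (IwasawaAlgebra p) ((PowerSeries (IwasawaAlgebra p) ⧸ I) ⧸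
      (Ideal.span {(PowerSeries.X : PowerSeries (IwasawaAlgebra p))} •
        (⊤ : Submodule (PowerSeries (IwasawaAlgebra p)) (PowerSeries (IwasawaAlgebra p) ⧸ I)))) = 1 := by
    refine finprod_mem_eq_one_of_forall_eq_one fun 𝔮 h𝔮 => ?_
    have h𝔮1 : 𝔮.asIdeal.height = 1 := h𝔮
    suffices h0 : lengthAt (IwasawaAlgebra p) ((PowerSeries (IwasawaAlgebra p) ⧸ I) ⧸
        (Ideal.span {(PowerSeries.X : PowerSeries (IwasawaAlgebra p))} •
          (⊤ : Submodule (PowerSeries (IwasawaAlgebra p)) (PowerSeries (IwasawaAlgebra p) ⧸ I)))) 𝔮 = 0 by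
      rw [h0, ENat.toNat_zero, pow_zero]
    by_cases hT : (PowerSeries.X : IwasawaAlgebra p) ∈ 𝔮.asIdeal
    · -- `𝔮 = (T)`, and `p ∉ (T)` kills the module
      have h𝔮T : 𝔮.asIdeal = Ideal.span {(PowerSeries.X : IwasawaAlgebra p)} :=
        Ideal.eq_span_singleton_of_height_eq_one h𝔮1 hT PowerSeries.X_prime
      refine lengthAt_eq_zero_of_isTorsionBy (s := (PowerSeries.C (p : ℤ_[p]) : IwasawaAlgebra p))
        (fun y => ?_) 𝔮 ?_
      · obtain ⟨x, rfl⟩ := Submodule.Quotient.mk_surjective _ y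
        rw [← Submodule.Quotient.mk_smul, hpact, Submodule.Quotient.mk_zero]
      · rw [h𝔮T, mem_span_X_iff (A := ℤ_[p]), PowerSeries.constantCoeff_C]
        exact_mod_cast (Fact.out : p.Prime).ne_zero
    · -- `T ∉ 𝔮` kills the module
      refine lengthAt_eq_zero_of_isTorsionBy (s := (PowerSeries.X : IwasawaAlgebra p)) (fun y => ?_) 𝔮 hT
      obtain ⟨x, rfl⟩ := Submodule.Quotient.mk_surjective _ y
      rw [← Submodule.Quotient.mk_smul, Submodule.Quotient.mk_eq_zero, hTact,
        Submodule.ideal_span_singleton_smul]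
      exact Submodule.smul_mem_pointwise_smul _ _ _ Submodule.mem_top
  rw [hL, hR, Ideal.one_eq_top, Ideal.span_singleton_eq_top] at heq
  exact (IwasawaAlgebra.prime_C p).not_unit heq

/-! ### The sibling fact `SkinnerUrban2014_cor_3_2_9_ii_specialization` is false as typed too
(appended 2026-08-27, sbc-p1 g7): same binder, same instance, same module `M = Λ₂/(p)` — the typed
containment `ch_{Λ₁}(M ⧸ T₁M) ≤ π(ch_{Λ₂} M)` reads `1 ≤ (p)`, false. -/

/-- Under the instance-resolved structure (`T ↦ T₁`), `π(ch_{Λ₂}(Λ₂/(p))) = (p) ⊂ Λ₁`.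
[cite: Delbourgo2008, Ch. X Lemma 10.5] -/
theorem map_constantCoeff_charIdeal_quotient_p (p : ℕ) [Fact p.Prime] :
    (charIdeal (PowerSeries (IwasawaAlgebra p)) (PowerSeries (IwasawaAlgebra p) ⧸
        Ideal.span {(PowerSeries.C (PowerSeries.C (p : ℤ_[p])) : PowerSeries (IwasawaAlgebra p))})).map
        (PowerSeries.constantCoeff (R := IwasawaAlgebra p)) =
      Ideal.span {(PowerSeries.C (p : ℤ_[p]) : IwasawaAlgebra p)} := by
  have hprime : Prime (PowerSeries.C (PowerSeries.C (p : ℤ_[p])) : PowerSeries (IwasawaAlgebra p)) :=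
    prime_C_of_prime (IwasawaAlgebra.prime_C p)
  haveI hIp : (Ideal.span {(PowerSeries.C (PowerSeries.C (p : ℤ_[p])) :
      PowerSeries (IwasawaAlgebra p))}).IsPrime :=
    (Ideal.span_singleton_prime hprime.ne_zero).mpr hprime
  let 𝔭 : PrimeSpectrum (PowerSeries (IwasawaAlgebra p)) := ⟨_, hIp⟩
  rw [charIdeal_quotient_prime_of_height_eq_one 𝔭 (height_span_singleton_eq_one_of_prime hprime),
    Ideal.map_span, Set.image_singleton, PowerSeries.constantCoeff_C]

/-- Under the instance-resolved structure (`T ↦ T₁`), `ch_{Λ₁}((Λ₂/(p)) ⧸ T₁) = 1`: the module is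
killed by `T` (acting as `T₁`) and by `p`. [cite: Delbourgo2008, Ch. X Lemma 10.5] -/
theorem charIdeal_quotient_p_quot_eq_one (p : ℕ) [Fact p.Prime] :
    charIdeal (IwasawaAlgebra p) ((PowerSeries (IwasawaAlgebra p) ⧸
        Ideal.span {(PowerSeries.C (PowerSeries.C (p : ℤ_[p])) : PowerSeries (IwasawaAlgebra p))}) ⧸
      (Ideal.span {(PowerSeries.X : PowerSeries (IwasawaAlgebra p))} •
        (⊤ : Submodule (PowerSeries (IwasawaAlgebra p)) (PowerSeries (IwasawaAlgebra p) ⧸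
          Ideal.span {(PowerSeries.C (PowerSeries.C (p : ℤ_[p])) : PowerSeries (IwasawaAlgebra p))})))) = 1 := by
  set π : PowerSeries (IwasawaAlgebra p) := PowerSeries.C (PowerSeries.C (p : ℤ_[p])) with hπ
  set I : Ideal (PowerSeries (IwasawaAlgebra p)) := Ideal.span {π} with hI
  have hπI : ∀ a : PowerSeries (IwasawaAlgebra p), Ideal.Quotient.mk I (π * a) = 0 := fun a =>
    Ideal.Quotient.eq_zero_iff_mem.mpr (Ideal.mul_mem_right _ _ (Ideal.mem_span_singleton_self π))
  have hTact : ∀ x : PowerSeries (IwasawaAlgebra p) ⧸ I,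
      (PowerSeries.X : IwasawaAlgebra p) • x = (PowerSeries.X : PowerSeries (IwasawaAlgebra p)) • x := by
    intro x
    rw [← IsScalarTower.algebraMap_smul (PowerSeries (IwasawaAlgebra p))
      (PowerSeries.X : IwasawaAlgebra p) x, PowerSeries.algebraMap_apply'', PowerSeries.map_X]
  have hpact : ∀ x : PowerSeries (IwasawaAlgebra p) ⧸ I,
      (PowerSeries.C (p : ℤ_[p]) : IwasawaAlgebra p) • x = 0 := by
    intro x
    obtain ⟨a, rfl⟩ := Ideal.Quotient.mk_surjective x
    rw [← IsScalarTower.algebraMap_smul (PowerSeries (IwasawaAlgebra p))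
      (PowerSeries.C (p : ℤ_[p]) : IwasawaAlgebra p), PowerSeries.algebraMap_apply'',
      PowerSeries.map_C, ← PowerSeries.C_eq_algebraMap]
    exact hπI a
  refine finprod_mem_eq_one_of_forall_eq_one fun 𝔮 h𝔮 => ?_
  have h𝔮1 : 𝔮.asIdeal.height = 1 := h𝔮
  suffices h0 : lengthAt (IwasawaAlgebra p) ((PowerSeries (IwasawaAlgebra p) ⧸ I) ⧸
      (Ideal.span {(PowerSeries.X : PowerSeries (IwasawaAlgebra p))} •
        (⊤ : Submodule (PowerSeries (IwasawaAlgebra p)) (PowerSeries (IwasawaAlgebra p) ⧸ I)))) 𝔮 = 0 by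
    rw [h0, ENat.toNat_zero, pow_zero]
  by_cases hT : (PowerSeries.X : IwasawaAlgebra p) ∈ 𝔮.asIdeal
  · have h𝔮T : 𝔮.asIdeal = Ideal.span {(PowerSeries.X : IwasawaAlgebra p)} :=
      Ideal.eq_span_singleton_of_height_eq_one h𝔮1 hT PowerSeries.X_prime
    refine lengthAt_eq_zero_of_isTorsionBy (s := (PowerSeries.C (p : ℤ_[p]) : IwasawaAlgebra p))
      (fun y => ?_) 𝔮 ?_
    · obtain ⟨x, rfl⟩ := Submodule.Quotient.mk_surjective _ y
      rw [← Submodule.Quotient.mk_smul, hpact, Submodule.Quotient.mk_zero]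
    · rw [h𝔮T, mem_span_X_iff (A := ℤ_[p]), PowerSeries.constantCoeff_C]
      exact_mod_cast (Fact.out : p.Prime).ne_zero
  · refine lengthAt_eq_zero_of_isTorsionBy (s := (PowerSeries.X : IwasawaAlgebra p)) (fun y => ?_) 𝔮 hT
    obtain ⟨x, rfl⟩ := Submodule.Quotient.mk_surjective _ y
    rw [← Submodule.Quotient.mk_smul, Submodule.Quotient.mk_eq_zero, hTact,
      Submodule.ideal_span_singleton_smul]
    exact Submodule.smul_mem_pointwise_smul _ _ _ Submodule.mem_top

/-- **Counterexample to the typed sibling fact `SkinnerUrban2014_cor_3_2_9_ii_specialization`.** For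
`M = Λ₂/(p)` with the instance-resolved `Λ₁`-structure (`T ↦ T₁`): `M/T₁M` is `Λ₁`-torsion (killed by
`T`), `ch_{Λ₁}(M/T₁M) = 1`, `π(ch_{Λ₂} M) = (p)`, and `1 ≤ (p)` fails. Hence that fact must be restated
with the constants structure as well. [cite: SkinnerUrban2013, Cor. 3.2.9 (ii) and its proof (p. 24)] -/
theorem not_SkinnerUrban2014_cor_3_2_9_ii_specialization_quotient_p (p : ℕ) [Fact p.Prime] :
    ¬ Literature.NumberTheory.EllipticCurves.IwasawaAlgebra.SkinnerUrban2014_cor_3_2_9_ii_specialization p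
      (PowerSeries (IwasawaAlgebra p) ⧸ Ideal.span {(PowerSeries.C (PowerSeries.C (p : ℤ_[p])) :
        PowerSeries (IwasawaAlgebra p))}) := by
  intro h
  set I : Ideal (PowerSeries (IwasawaAlgebra p)) :=
    Ideal.span {(PowerSeries.C (PowerSeries.C (p : ℤ_[p])) : PowerSeries (IwasawaAlgebra p))} with hI
  haveI : Module.Finite (PowerSeries (IwasawaAlgebra p)) (PowerSeries (IwasawaAlgebra p) ⧸ I) :=
    inferInstance
  have hTact : ∀ x : PowerSeries (IwasawaAlgebra p) ⧸ I,
      (PowerSeries.X : IwasawaAlgebra p) • x = (PowerSeries.X : PowerSeries (IwasawaAlgebra p)) • x := by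
    intro x
    rw [← IsScalarTower.algebraMap_smul (PowerSeries (IwasawaAlgebra p))
      (PowerSeries.X : IwasawaAlgebra p) x, PowerSeries.algebraMap_apply'', PowerSeries.map_X]
  have hq : Module.IsTorsion (IwasawaAlgebra p) ((PowerSeries (IwasawaAlgebra p) ⧸ I) ⧸
      (Ideal.span {(PowerSeries.X : PowerSeries (IwasawaAlgebra p))} •
        (⊤ : Submodule (PowerSeries (IwasawaAlgebra p)) (PowerSeries (IwasawaAlgebra p) ⧸ I)))) := by
    intro y
    obtain ⟨x, rfl⟩ := Submodule.Quotient.mk_surjective _ y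
    refine ⟨⟨PowerSeries.X, mem_nonZeroDivisors_of_ne_zero PowerSeries.X_ne_zero⟩, ?_⟩
    rw [Submonoid.smul_def, ← Submodule.Quotient.mk_smul, Submodule.Quotient.mk_eq_zero]
    change (PowerSeries.X : IwasawaAlgebra p) • x ∈ _
    rw [hTact, Submodule.ideal_span_singleton_smul]
    exact Submodule.smul_mem_pointwise_smul _ _ _ Submodule.mem_top
  have hle := h hq
  rw [charIdeal_quotient_p_quot_eq_one p, map_constantCoeff_charIdeal_quotient_p p, Ideal.one_eq_top,
    top_le_iff, Ideal.span_singleton_eq_top] at hle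
  exact (IwasawaAlgebra.prime_C p).not_unit hle

end TwoVar

end Summit.BirchSwinnertonDyer.BirchSwinnertonDyer.Theorems.SignedBaseChangeAcDivSpecialization

end
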